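/-
Copyright (c) 2026. All rights reserved.
Released under Apache 2.0 license as described in the file LICENSE.
Authors: abc-iut cell, wave-5 seat abc-iut-w5-d141 (L3 sub-DAG [SemiAnbd] Thm 5.4, row T54-7c).
-/
import Literature.AnabelianGeometry.SemiGraphs.ArithQuasiGeometricSurjective
import Literature.AnabelianGeometry.SemiGraphs.ArithQuasiGeometricRelSlim
import Literature.AnabelianGeometry.SemiGraphs.ArithMaximalCompactReductions
import Literature.AnabelianGeometry.SemiGraphs.ArithIntersectionWithGeometricProofs
import HarnessLib

/-!
# [SemiAnbd] Theorem 5.4 (iii), clause 3 under the COMPATIBLE reading (sub-DAG SemiAnbd-Thm54, row T54-7c;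
# proof-only; repair of finding W4d083-F2 on the binder `hCor39` of `Thm54iii.clause3_of_geometric`)

Mochizuki, *Semi-graphs of anabelioids*, Publ. RIMS **42** (2006), §5, Theorem 5.4 (iii) p. 66, with §3
Def 3.8 / Cor 3.9 pp. 42–43 [cite: MochizukiSemiAnbd2006, Thm 5.4 (iii), p. 66].

WHY THIS FILE.  `Thm54iii.clause3_of_geometric` (this seat, `ArithQuasiGeometricSurjective.lean`) derives clause 3
of the typed `ArithQuasiGeometricCorrespondenceStatement` (abc-iut-L3-t3) from the binder `hCor39` = the LITERAL
geometric Cor 3.9 (b) at the kernels.  Finding W4d083-F2 (abc-iut-w4-d083): the tree's geometric Cor 3.9 (b) is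
the COMPATIBLE twin only (`IsCompatiblyQuasiGeometric`, finding t2g2-F1 / ruling χ2: under the literal Def 3.8
the "fold" `Π_{v₁} *_{Π_e} Π_{v₂} → Π_w` is quasi-geometric yet induced by no morphism of semi-graphs; negative
knowledge O-Cor39-1), so `hCor39` as shaped is not dischargeable from the tree, and — p. 66 "entirely parallel
to … Corollary 3.9" — the typed `IsArithQuasiGeometric` inherits the same gap (the fold of the arithmetic
double `v₁ —e— v₂` of one arithmetic vertex glued along one arithmetically estranged branch, folded onto
`Π^temp_{𝔊,v₁}` through `Π̂_𝔊`, is continuous, over `A`, literally arithmetically quasi-geometric by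
Thm 5.4 (ii), and conjugate to no `B^temp(φ)`).  The implication `Thm54iii.clause3_of_geometric` stays TRUE;
this ADDITIVE file (no landed byte touched, no `def`, nothing asserted) proves the COMPATIBLE twin of clause 3:

* `Thm54iii.clause3_of_geomInduced` — Steps C–E of the arithmetic translation ISOLATED: an arithmetically
  quasi-geometric `f` over `A` whose restriction to `Ker augG = Π^temp_𝔾` is `B^temp(g)|_{geom}` up to a
  geometric inner automorphism (for SOME `g : 𝔾 → ℍ` — the output of ANY reading of Cor 3.9 (b)) is a
  conjugate of `B^temp(φ)` for the arithmetic morphism `φ = (e, g)` over `A`;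
* `geomCompatShadow_of_arithCompat` — Step A for the compatibility clause: the ARITHMETIC compatibility
  clause for `f` ("distinct arithmetically maximal compact subgroups with arithmetically ample intersection
  are carried INTO distinct arithmetically maximal compact subgroups" — the literal arithmetic translation of
  `IsCompatiblyQuasiGeometric.compat`, 'nontrivial' ↦ 'arithmetically ample') yields its GEOMETRIC shadow
  at the kernels, via Thm 5.4 (ii) on both sides, Rmk 5.3.1 on the `𝔊`-side, the commensurator description
  of p. 65 on the `ℍ`-side and the `𝔊`-side shadow `hadj` of the geometric Thm 3.7 (iii) ("a nontrivial
  compact subgroup contained in two distinct verticial subgroups … joined by a single edge … contained in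
  some edge-like subgroup", p. 41);
* `Thm54iii.clause3Compat_of_geometric` / `…'` — clause 3 for arithmetically COMPATIBLY quasi-geometric `f`
  from `hCor39c` := the COMPATIBLE geometric Cor 3.9 (b) at the kernels (antecedent = the vertex /
  branch shadows of `hCor39` PLUS the kernel-level compatibility shadow — the text of abc-iut-w4-d083's
  F2-SHAPES-hCor39c.md (R2), verbatim; this is the shape the producer
  discharges through the tempered chart by abc-iut-w4-d080's
  `ProfiniteSemiGraph.exists_hom_chartPullbackWith_iso_of_isCompatiblyQuasiGeometric`, p414994, modulo
  Thm 3.7 (iii) `CompactInVerticial`, and abc-iut-w4-d082's T54-B-func).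

Every hypothesis is an INLINE shape over `(D, D', augG, augH')` or the data `ι`, `btemp` (no `def … : Prop`,
D-0067 (1)).  No side taken on [IUTchIII] Cor. 3.12; typed ≠ proved for the inputs.
-/

namespace Literature.AnabelianGeometry.SemiGraphs

open _root_.CategoryTheory
open Literature.AlgebraicGeometry.Frobenioids (IsSlimGroup)

universe u v w uG uH uP uV uB uV' uB'

/-! ### Step A for the compatibility clause (pure group theory over the data of p. 65) -/

section StepACompat

variable {Gtp : Type uG} [Group Gtp] [TopologicalSpace Gtp]
variable {Htp : Type uH} [Group Htp] [TopologicalSpace Htp]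
variable {PA : Type uP} [Group PA] [TopologicalSpace PA] [ContinuousMul PA]
variable {V : Type uV} {B : Type uB} {V' : Type uV'} {B' : Type uB'}
variable {D : DecompositionData Gtp V B} {D' : DecompositionData Htp V' B'}
variable {augG : Gtp →* PA} {augH' : Htp →* PA} {f : Gtp →* Htp}

/-- **Step A for the compatibility clause.** If `f` carries distinct arithmetically maximal compact subgroups
with arithmetically ample intersection INTO distinct arithmetically maximal compact subgroups (the arithmetic
translation of the compatible reading of Def 3.8, 'nontrivial' ↦ 'arithmetically ample'), then, for two verticial
subgroups of `Π^temp_𝔊` whose GEOMETRIC parts are distinct and meet nontrivially, `f` carries these geometric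
parts into two verticial subgroups of `Π^temp_ℍ` with DISTINCT geometric parts (the third antecedent of `hCor39c`,
text of abc-iut-w4-d083's F2-SHAPES (R2)).  Inputs: Thm 5.4 (ii)
on both sides (`hIIG`, `hIIH`), Rmk 5.3.1 on the `𝔊`-side (`hRG`: edge-like ⇒ arithmetically ample), the
commensurator description of p. 65 on the `ℍ`-side (`hcommV'`), and the `𝔊`-side shadow `hadj` of the
geometric Thm 3.7 (iii): two verticial subgroups whose geometric parts are distinct and meet nontrivially
contain a common edge-like subgroup. [cite: MochizukiSemiAnbd2006, Thm 5.4 (iii), p. 66] -/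
theorem geomCompatShadow_of_arithCompat (hIIG : ArithMaximalCompactStatementII D augG)
    (hIIH : ArithMaximalCompactStatementII D' augH') (hRG : VerticialEdgeLikeCompactAmpleStatement D augG)
    (hcommV' : ∀ w : V', Subgroup.Commensurable.commensurator (D'.vertGp w ⊓ augH'.ker) = D'.vertGp w)
    (hadj : ∀ (v₁ v₂ : V) (γ₁ γ₂ : Gtp),
      conjSubgroup γ₁ (D.vertGp v₁) ⊓ augG.ker ≠ conjSubgroup γ₂ (D.vertGp v₂) ⊓ augG.ker →
      conjSubgroup γ₁ (D.vertGp v₁) ⊓ conjSubgroup γ₂ (D.vertGp v₂) ⊓ augG.ker ≠ ⊥ →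
        ∃ E : Subgroup Gtp, IsEdgeLike D E ∧ E ≤ conjSubgroup γ₁ (D.vertGp v₁) ⊓ conjSubgroup γ₂ (D.vertGp v₂))
    (hcompat : ∀ K₁ H₁ : Subgroup Gtp, IsArithMaximalCompact augG K₁ → IsArithMaximalCompact augG H₁ →
      K₁ ≠ H₁ → IsArithAmple augG (K₁ ⊓ H₁) →
        ∃ K₂ H₂ : Subgroup Htp, IsArithMaximalCompact augH' K₂ ∧ IsArithMaximalCompact augH' H₂ ∧
          K₂ ≠ H₂ ∧ K₁.map f ≤ K₂ ∧ H₁.map f ≤ H₂) :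
    ∀ (v₁ v₂ : V) (γ₁ γ₂ : Gtp),
      conjSubgroup γ₁ (D.vertGp v₁) ⊓ augG.ker ≠ conjSubgroup γ₂ (D.vertGp v₂) ⊓ augG.ker →
      conjSubgroup γ₁ (D.vertGp v₁) ⊓ conjSubgroup γ₂ (D.vertGp v₂) ⊓ augG.ker ≠ ⊥ →
        ∃ (w₁ w₂ : V') (x₁ x₂ : Htp),
          conjSubgroup x₁ (D'.vertGp w₁) ⊓ augH'.ker ≠ conjSubgroup x₂ (D'.vertGp w₂) ⊓ augH'.ker ∧
            (conjSubgroup γ₁ (D.vertGp v₁) ⊓ augG.ker).map f ≤ conjSubgroup x₁ (D'.vertGp w₁) ∧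
              (conjSubgroup γ₂ (D.vertGp v₂) ⊓ augG.ker).map f ≤ conjSubgroup x₂ (D'.vertGp w₂) := by
  intro v₁ v₂ γ₁ γ₂ hne hnt
  have hK₁ : IsArithMaximalCompact augG (conjSubgroup γ₁ (D.vertGp v₁)) := (hIIG.1 _).mpr ⟨v₁, γ₁, rfl⟩
  have hH₁ : IsArithMaximalCompact augG (conjSubgroup γ₂ (D.vertGp v₂)) := (hIIG.1 _).mpr ⟨v₂, γ₂, rfl⟩
  have hne' : conjSubgroup γ₁ (D.vertGp v₁) ≠ conjSubgroup γ₂ (D.vertGp v₂) := fun h => hne (by rw [h])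
  obtain ⟨E, hE, hEle⟩ := hadj v₁ v₂ γ₁ γ₂ hne hnt
  have hamp : IsArithAmple augG (conjSubgroup γ₁ (D.vertGp v₁) ⊓ conjSubgroup γ₂ (D.vertGp v₂)) :=
    (hRG E (Or.inr hE)).2.mono hEle
  obtain ⟨K₂, H₂, hK₂, hH₂, hne₂, hK₁₂, hH₁₂⟩ := hcompat _ _ hK₁ hH₁ hne' hamp
  obtain ⟨w₁, x₁, rfl⟩ := (hIIH.1 K₂).mp hK₂
  obtain ⟨w₂, x₂, rfl⟩ := (hIIH.1 H₂).mp hH₂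
  refine ⟨w₁, w₂, x₁, x₂, fun heq => hne₂ ?_, ?_, ?_⟩
  · rw [← commensurator_inf_ker_eq_of_isVerticial D' augH' hcommV' ⟨w₁, x₁, rfl⟩,
      ← commensurator_inf_ker_eq_of_isVerticial D' augH' hcommV' ⟨w₂, x₂, rfl⟩, heq]
  · exact (Subgroup.map_mono inf_le_left).trans hK₁₂
  · exact (Subgroup.map_mono inf_le_left).trans hH₁₂

end StepACompat

/-! ### Steps C–E isolated: from "`f|_{Π^temp_𝔾}` is `B^temp(g)|_{geom}` up to a geometric inner automorphism" to clause 3 -/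

section Main

variable {Obj : Type u} [Category.{v} Obj] {𝓥 : SemiAnbdVocab.{u, v, w} Obj}
variable {𝔊 ℍ : ArithSemiGraph 𝓥} {e : 𝔊.PA ≃* ℍ.PA}
variable {Gtp : Type uG} [Group Gtp] [TopologicalSpace Gtp]
variable {Htp : Type uH} [Group Htp] [TopologicalSpace Htp]
variable {V : Type uV} {B : Type uB} {V' : Type uV'} {B' : Type uB'}
variable {D : DecompositionData Gtp V B} {D' : DecompositionData Htp V' B'}

/-- **Steps C–E of the arithmetic translation, isolated** ([SemiAnbd] Thm 5.4 (iii) p. 66): an arithmetically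
quasi-geometric `f : Π^temp_𝔊 → Π^temp_ℍ` over `A` whose restriction to `Ker augG = Π^temp_𝔾` agrees, up to a
GEOMETRIC inner automorphism, with `ι g = B^temp(g)|_{geom}` for SOME morphism `g : 𝔾 → ℍ` of the geometric
components — the output of Cor 3.9 (b) under ANY reading (literal, compatible, up to twist) — is a conjugate of
`B^temp(φ)` for the arithmetic morphism `φ = (e, g)` over `A`: Step C (`geom_compat_of_over`: `g` is
`Π_A`-equivariant, from the Prop 5.2 (iv) dictionary `hιG` / `hιH` and injectivity `hιinj`), Step D (`hιbtemp`),
Step E (`eq_of_kerAgree_of_centralizer`, relative temp-slimness `hZ` applied to the open image of the geometric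
part of a verticial subgroup, which exists by Step A `geomShadowV_of_isArithQuasiGeometric`).
[cite: MochizukiSemiAnbd2006, Thm 5.4 (iii), p. 66] -/
theorem Thm54iii.clause3_of_geomInduced (augG : Gtp →* 𝔊.PA) (augH' : Htp →* 𝔊.PA)
    (btemp : (φ : ArithHom 𝓥 𝔊 ℍ) → φ.IsLocallyOpen → ArithHom.IsOverA 𝔊 ℍ e φ → (Gtp →* Htp))
    (hIIG : ArithMaximalCompactStatementII D augG) (hIIH : ArithMaximalCompactStatementII D' augH')
    (hover : ∀ (φ : ArithHom 𝓥 𝔊 ℍ) (h₁ : φ.IsLocallyOpen) (h₂ : ArithHom.IsOverA 𝔊 ℍ e φ),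
      augH'.comp (btemp φ h₁ h₂) = augG)
    (ι : (𝔊.G ⟶ ℍ.G) → (augG.ker →* Htp))
    (hιG : ∀ (g : 𝔊.G ⟶ ℍ.G) (a : 𝔊.PA) (γ : Gtp), augG γ = a → ∃ δ ∈ augH'.ker,
      ∀ x : augG.ker, ι ((𝔊.ρ a).hom ≫ g) x =
        δ * ι g ⟨γ * x * γ⁻¹, (MonoidHom.normal_ker augG).conj_mem _ x.2 γ⟩ * δ⁻¹)
    (hιH : ∀ (g : 𝔊.G ⟶ ℍ.G) (a : 𝔊.PA) (η : Htp), augH' η = a → ∃ δ ∈ augH'.ker,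
      ∀ x : augG.ker, ι (g ≫ (ℍ.ρ (e a)).hom) x = δ * (η * ι g x * η⁻¹) * δ⁻¹)
    (hιinj : ∀ g₁ g₂ : 𝔊.G ⟶ ℍ.G,
      (∃ δ ∈ augH'.ker, ∀ x : augG.ker, ι g₁ x = δ * ι g₂ x * δ⁻¹) → g₁ = g₂)
    (hιbtemp : ∀ (φ : ArithHom 𝓥 𝔊 ℍ) (h₁ : φ.IsLocallyOpen) (h₂ : ArithHom.IsOverA 𝔊 ℍ e φ),
      ∃ δ ∈ augH'.ker, ∀ x : augG.ker, btemp φ h₁ h₂ x = δ * ι φ.geom x * δ⁻¹)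
    (hZ : ∀ (w : V') (x : Htp) (U : Subgroup Htp), U ≤ conjSubgroup x (D'.vertGp w) ⊓ augH'.ker →
      IsOpen ((Subtype.val : (conjSubgroup x (D'.vertGp w) ⊓ augH'.ker : Subgroup Htp) → Htp) ⁻¹'
        (U : Set Htp)) →
      ∀ z ∈ augH'.ker, (∀ u ∈ U, z * u = u * z) → z = 1)
    (hsurjG : Function.Surjective augG) (he : Continuous e) (hV : Nonempty V)
    {f : Gtp →* Htp} (hf : IsArithQuasiGeometric augG augH' f)
    (hind : ∃ (g : 𝔊.G ⟶ ℍ.G), ∃ h ∈ augH'.ker, ∀ x : augG.ker, f x = h * ι g x * h⁻¹) :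
    ∃ (φ : ArithHom 𝓥 𝔊 ℍ) (h₁ : φ.IsLocallyOpen) (h₂ : ArithHom.IsOverA 𝔊 ℍ e φ) (h : Htp),
      ∀ g, f g = h * btemp φ h₁ h₂ g * h⁻¹ := by
  obtain ⟨g, h, hh, hfg⟩ := hind
  -- Step C: equivariance, hence an arithmetic morphism `φ = (e, g)` over `A`
  have hcompat : ∀ a : 𝔊.PA, (𝔊.ρ a).hom ≫ g = g ≫ (ℍ.ρ (e.toMonoidHom a)).hom := fun a =>
    geom_compat_of_over ι hιG hιH hιinj hsurjG hf.2.1 hh hfg a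
  let φ : ArithHom 𝓥 𝔊 ℍ :=
    { arith := e.toMonoidHom, continuous_arith := he, geom := g, compat := hcompat }
  have h₁ : φ.IsLocallyOpen := by
    show IsOpen (Set.range (e.toMonoidHom : 𝔊.PA → ℍ.PA))
    have hr : Set.range (e.toMonoidHom : 𝔊.PA → ℍ.PA) = Set.univ := by
      rw [MulEquiv.coe_toMonoidHom]
      exact Set.range_eq_univ.mpr e.surjective
    rw [hr]
    exact isOpen_univ
  have h₂ : ArithHom.IsOverA 𝔊 ℍ e φ := fun a => rfl
  -- Step D: agreement on the kernel with a conjugate of `btemp φ`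
  obtain ⟨δ, hδ, hbt⟩ := hιbtemp φ h₁ h₂
  have hk : h * δ⁻¹ ∈ augH'.ker := augH'.ker.mul_mem hh (augH'.ker.inv_mem hδ)
  have hagree : ∀ x ∈ augG.ker,
      f x = (MulAut.conj (h * δ⁻¹)).toMonoidHom.comp (btemp φ h₁ h₂) x := by
    intro x hx
    have e1 := hfg ⟨x, hx⟩
    have e2 := hbt ⟨x, hx⟩
    change btemp φ h₁ h₂ x = δ * ι g ⟨x, hx⟩ * δ⁻¹ at e2
    change f x = h * ι g ⟨x, hx⟩ * h⁻¹ at e1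
    change f x = (h * δ⁻¹) * btemp φ h₁ h₂ x * (h * δ⁻¹)⁻¹
    rw [e1, e2]
    group
  -- Step E: the two homomorphisms over `A` agree everywhere
  refine ⟨φ, h₁, h₂, h * δ⁻¹, fun γ => ?_⟩
  obtain ⟨v₀⟩ := hV
  obtain ⟨w, x, -, hU⟩ := geomShadowV_of_isArithQuasiGeometric hIIG hIIH hf v₀
  have hF : augH'.comp ((MulAut.conj (h * δ⁻¹)).toMonoidHom.comp (btemp φ h₁ h₂)) = augG := by
    ext y
    have hk1 : augH' (h * δ⁻¹) = 1 := hk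
    have hy := congrArg (fun ψ : Gtp →* 𝔊.PA => ψ y) (hover φ h₁ h₂)
    simp only [MonoidHom.comp_apply] at hy ⊢
    rw [MulEquiv.coe_toMonoidHom, MulAut.conj_apply, map_mul, map_mul, map_inv, hk1, hy, one_mul,
      inv_one, mul_one]
  have key := eq_of_kerAgree_of_centralizer hf.2.1 hF hagree (D.vertGp v₀ ⊓ augG.ker) inf_le_right
    (hZ w x _ hU.1 hU.2) γ
  rw [key]
  rfl

/-- **[SemiAnbd] Theorem 5.4 (iii), clause 3 (surjectivity) under the COMPATIBLE reading, from geometric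
inputs**: every continuous `f : Π^temp_𝔊 → Π^temp_ℍ` over `A` that is arithmetically quasi-geometric AND carries
distinct arithmetically maximal compact subgroups with arithmetically ample intersection into distinct
arithmetically maximal compact subgroups arises, up to an inner automorphism of `Π^temp_ℍ`, from a locally open
morphism `𝔊 → ℍ` over `A` ("the proofs are entirely parallel to those of Theorem 3.7, Corollary 3.9", p. 66 — here
parallel to Cor 3.9 under the compatible reading of Def 3.8).  INPUTS (inline shapes; rows of sub-DAG
SemiAnbd-Thm54 / SemiAnbd-Cor39 and producer debts T54-0/T54-B, nothing asserted): Thm 5.4 (ii) on both sides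
(`hIIG`, `hIIH`); Rmk 5.3.1 on the `𝔊`-side (`hRG`); the commensurator description of p. 65 on the `ℍ`-side
(`hcommV'`); the `𝔊`-side shadow of the geometric Thm 3.7 (iii) (`hadj`); the COMPATIBLE geometric Cor 3.9 (b) at
the kernels (`hCor39c`: rows R2′ + R3 of record, `exists_hom_chartPullbackWith_iso_of_isCompatiblyQuasiGeometric`,
through the tempered chart) over the datum `ι = B^temp(−)|_{geom}` with its Prop 5.2 (iv) dictionary (`hιG`,
`hιH`), injectivity (`hιinj`) and its tie to the arithmetic `B^temp` (`hιbtemp`); `B^temp(φ)` over `A` (`hover`);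
surjectivity of `augG`; continuity of `e`; a vertex of `𝔾`; relative temp-slimness (`hZ`).
[cite: MochizukiSemiAnbd2006, Thm 5.4 (iii), p. 66] -/
theorem Thm54iii.clause3Compat_of_geometric (augG : Gtp →* 𝔊.PA) (augH' : Htp →* 𝔊.PA)
    (btemp : (φ : ArithHom 𝓥 𝔊 ℍ) → φ.IsLocallyOpen → ArithHom.IsOverA 𝔊 ℍ e φ → (Gtp →* Htp))
    (hIIG : ArithMaximalCompactStatementII D augG) (hIIH : ArithMaximalCompactStatementII D' augH')
    (hRG : VerticialEdgeLikeCompactAmpleStatement D augG)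
    (hcommV' : ∀ w : V', Subgroup.Commensurable.commensurator (D'.vertGp w ⊓ augH'.ker) = D'.vertGp w)
    (hadj : ∀ (v₁ v₂ : V) (γ₁ γ₂ : Gtp),
      conjSubgroup γ₁ (D.vertGp v₁) ⊓ augG.ker ≠ conjSubgroup γ₂ (D.vertGp v₂) ⊓ augG.ker →
      conjSubgroup γ₁ (D.vertGp v₁) ⊓ conjSubgroup γ₂ (D.vertGp v₂) ⊓ augG.ker ≠ ⊥ →
        ∃ E : Subgroup Gtp, IsEdgeLike D E ∧ E ≤ conjSubgroup γ₁ (D.vertGp v₁) ⊓ conjSubgroup γ₂ (D.vertGp v₂))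
    (hover : ∀ (φ : ArithHom 𝓥 𝔊 ℍ) (h₁ : φ.IsLocallyOpen) (h₂ : ArithHom.IsOverA 𝔊 ℍ e φ),
      augH'.comp (btemp φ h₁ h₂) = augG)
    (ι : (𝔊.G ⟶ ℍ.G) → (augG.ker →* Htp))
    (hιG : ∀ (g : 𝔊.G ⟶ ℍ.G) (a : 𝔊.PA) (γ : Gtp), augG γ = a → ∃ δ ∈ augH'.ker,
      ∀ x : augG.ker, ι ((𝔊.ρ a).hom ≫ g) x =
        δ * ι g ⟨γ * x * γ⁻¹, (MonoidHom.normal_ker augG).conj_mem _ x.2 γ⟩ * δ⁻¹)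
    (hιH : ∀ (g : 𝔊.G ⟶ ℍ.G) (a : 𝔊.PA) (η : Htp), augH' η = a → ∃ δ ∈ augH'.ker,
      ∀ x : augG.ker, ι (g ≫ (ℍ.ρ (e a)).hom) x = δ * (η * ι g x * η⁻¹) * δ⁻¹)
    (hιinj : ∀ g₁ g₂ : 𝔊.G ⟶ ℍ.G,
      (∃ δ ∈ augH'.ker, ∀ x : augG.ker, ι g₁ x = δ * ι g₂ x * δ⁻¹) → g₁ = g₂)
    (hιbtemp : ∀ (φ : ArithHom 𝓥 𝔊 ℍ) (h₁ : φ.IsLocallyOpen) (h₂ : ArithHom.IsOverA 𝔊 ℍ e φ),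
      ∃ δ ∈ augH'.ker, ∀ x : augG.ker, btemp φ h₁ h₂ x = δ * ι φ.geom x * δ⁻¹)
    (hCor39c : ∀ f : Gtp →* Htp, Continuous f → augH'.comp f = augG →
      (∀ v : V, ∃ (w : V') (x : Htp),
        MapsOntoOpenSubgroupOf f (D.vertGp v ⊓ augG.ker) (conjSubgroup x (D'.vertGp w) ⊓ augH'.ker)) →
      (∀ b : B, ∃ (b' : B') (x : Htp),
        MapsOntoOpenSubgroupOf f (D.brGp b ⊓ augG.ker) (conjSubgroup x (D'.brGp b') ⊓ augH'.ker)) →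
      (∀ (v₁ v₂ : V) (γ₁ γ₂ : Gtp),
        conjSubgroup γ₁ (D.vertGp v₁) ⊓ augG.ker ≠ conjSubgroup γ₂ (D.vertGp v₂) ⊓ augG.ker →
        conjSubgroup γ₁ (D.vertGp v₁) ⊓ conjSubgroup γ₂ (D.vertGp v₂) ⊓ augG.ker ≠ ⊥ →
          ∃ (w₁ w₂ : V') (x₁ x₂ : Htp),
            conjSubgroup x₁ (D'.vertGp w₁) ⊓ augH'.ker ≠ conjSubgroup x₂ (D'.vertGp w₂) ⊓ augH'.ker ∧
              (conjSubgroup γ₁ (D.vertGp v₁) ⊓ augG.ker).map f ≤ conjSubgroup x₁ (D'.vertGp w₁) ∧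
                (conjSubgroup γ₂ (D.vertGp v₂) ⊓ augG.ker).map f ≤ conjSubgroup x₂ (D'.vertGp w₂)) →
      ∃ (g : 𝔊.G ⟶ ℍ.G), ∃ h ∈ augH'.ker, ∀ x : augG.ker, f x = h * ι g x * h⁻¹)
    (hZ : ∀ (w : V') (x : Htp) (U : Subgroup Htp), U ≤ conjSubgroup x (D'.vertGp w) ⊓ augH'.ker →
      IsOpen ((Subtype.val : (conjSubgroup x (D'.vertGp w) ⊓ augH'.ker : Subgroup Htp) → Htp) ⁻¹'
        (U : Set Htp)) →
      ∀ z ∈ augH'.ker, (∀ u ∈ U, z * u = u * z) → z = 1)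
    (hsurjG : Function.Surjective augG) (he : Continuous e) (hV : Nonempty V) :
    ∀ f : Gtp →* Htp, IsArithQuasiGeometric augG augH' f →
      (∀ K₁ H₁ : Subgroup Gtp, IsArithMaximalCompact augG K₁ → IsArithMaximalCompact augG H₁ →
        K₁ ≠ H₁ → IsArithAmple augG (K₁ ⊓ H₁) →
          ∃ K₂ H₂ : Subgroup Htp, IsArithMaximalCompact augH' K₂ ∧ IsArithMaximalCompact augH' H₂ ∧
            K₂ ≠ H₂ ∧ K₁.map f ≤ K₂ ∧ H₁.map f ≤ H₂) →
      ∃ (φ : ArithHom 𝓥 𝔊 ℍ) (h₁ : φ.IsLocallyOpen) (h₂ : ArithHom.IsOverA 𝔊 ℍ e φ) (h : Htp),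
        ∀ g, f g = h * btemp φ h₁ h₂ g * h⁻¹ := by
  intro f hf hcf
  refine Thm54iii.clause3_of_geomInduced augG augH' btemp hIIG hIIH hover ι hιG hιH hιinj hιbtemp hZ hsurjG
    he hV hf ?_
  -- Step A (+ its compatibility twin) + Step B (the compatible geometric Cor 3.9 (b) at the kernels)
  exact hCor39c f hf.1 hf.2.1
    (fun v => by
      obtain ⟨w, x, -, hgeo⟩ := geomShadowV_of_isArithQuasiGeometric hIIG hIIH hf v
      exact ⟨w, x, hgeo⟩)
    (fun b => by
      obtain ⟨b', x, -, hgeo⟩ := geomShadowE_of_isArithQuasiGeometric hIIG hIIH hf b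
      exact ⟨b', x, hgeo⟩)
    (geomCompatShadow_of_arithCompat hIIG hIIH hRG hcommV' hadj hcf)

end Main

/-! ### Producer-currency form (relative temp-slimness from Rmk 5.3.1, p. 65 and verticial slimness) -/

section OfSlim

variable {Obj : Type u} [Category.{v} Obj] {𝓥 : SemiAnbdVocab.{u, v, w} Obj}
variable {𝔊 ℍ : ArithSemiGraph 𝓥} {e : 𝔊.PA ≃* ℍ.PA}
variable {Gtp : Type uG} [Group Gtp] [TopologicalSpace Gtp]
variable {Htp : Type uH} [Group Htp] [TopologicalSpace Htp] [IsTopologicalGroup Htp] [T2Space Htp]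
variable {V : Type uV} {B : Type uB} {V' : Type uV'} {B' : Type uB'}
variable {D : DecompositionData Gtp V B} {D' : DecompositionData Htp V' B'}

/-- **[SemiAnbd] Thm 5.4 (iii) clause 3 under the compatible reading, producer-currency form**: as
`Thm54iii.clause3Compat_of_geometric`, with relative temp-slimness supplied (`relSlim_of_commensurator_slim`) by
Rmk 5.3.1 on the `ℍ`-side (`hRH`), the commensurator description of p. 65 (`hcommV'`), continuity of `augH'` and
slimness of the geometric verticial subgroups of `Π^temp_ℍ` (`hslim`).
[cite: MochizukiSemiAnbd2006, Thm 5.4 (iii), p. 66] -/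
theorem Thm54iii.clause3Compat_of_geometric' (augG : Gtp →* 𝔊.PA) (augH' : Htp →* 𝔊.PA)
    (btemp : (φ : ArithHom 𝓥 𝔊 ℍ) → φ.IsLocallyOpen → ArithHom.IsOverA 𝔊 ℍ e φ → (Gtp →* Htp))
    (hIIG : ArithMaximalCompactStatementII D augG) (hIIH : ArithMaximalCompactStatementII D' augH')
    (hRG : VerticialEdgeLikeCompactAmpleStatement D augG) (hRH : VerticialEdgeLikeCompactAmpleStatement D' augH')
    (haugH : Continuous augH')
    (hcommV' : ∀ w : V', Subgroup.Commensurable.commensurator (D'.vertGp w ⊓ augH'.ker) = D'.vertGp w)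
    (hslim : ∀ (w : V') (x : Htp), IsSlimGroup (conjSubgroup x (D'.vertGp w) ⊓ augH'.ker : Subgroup Htp))
    (hadj : ∀ (v₁ v₂ : V) (γ₁ γ₂ : Gtp),
      conjSubgroup γ₁ (D.vertGp v₁) ⊓ augG.ker ≠ conjSubgroup γ₂ (D.vertGp v₂) ⊓ augG.ker →
      conjSubgroup γ₁ (D.vertGp v₁) ⊓ conjSubgroup γ₂ (D.vertGp v₂) ⊓ augG.ker ≠ ⊥ →
        ∃ E : Subgroup Gtp, IsEdgeLike D E ∧ E ≤ conjSubgroup γ₁ (D.vertGp v₁) ⊓ conjSubgroup γ₂ (D.vertGp v₂))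
    (hover : ∀ (φ : ArithHom 𝓥 𝔊 ℍ) (h₁ : φ.IsLocallyOpen) (h₂ : ArithHom.IsOverA 𝔊 ℍ e φ),
      augH'.comp (btemp φ h₁ h₂) = augG)
    (ι : (𝔊.G ⟶ ℍ.G) → (augG.ker →* Htp))
    (hιG : ∀ (g : 𝔊.G ⟶ ℍ.G) (a : 𝔊.PA) (γ : Gtp), augG γ = a → ∃ δ ∈ augH'.ker,
      ∀ x : augG.ker, ι ((𝔊.ρ a).hom ≫ g) x =
        δ * ι g ⟨γ * x * γ⁻¹, (MonoidHom.normal_ker augG).conj_mem _ x.2 γ⟩ * δ⁻¹)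
    (hιH : ∀ (g : 𝔊.G ⟶ ℍ.G) (a : 𝔊.PA) (η : Htp), augH' η = a → ∃ δ ∈ augH'.ker,
      ∀ x : augG.ker, ι (g ≫ (ℍ.ρ (e a)).hom) x = δ * (η * ι g x * η⁻¹) * δ⁻¹)
    (hιinj : ∀ g₁ g₂ : 𝔊.G ⟶ ℍ.G,
      (∃ δ ∈ augH'.ker, ∀ x : augG.ker, ι g₁ x = δ * ι g₂ x * δ⁻¹) → g₁ = g₂)
    (hιbtemp : ∀ (φ : ArithHom 𝓥 𝔊 ℍ) (h₁ : φ.IsLocallyOpen) (h₂ : ArithHom.IsOverA 𝔊 ℍ e φ),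
      ∃ δ ∈ augH'.ker, ∀ x : augG.ker, btemp φ h₁ h₂ x = δ * ι φ.geom x * δ⁻¹)
    (hCor39c : ∀ f : Gtp →* Htp, Continuous f → augH'.comp f = augG →
      (∀ v : V, ∃ (w : V') (x : Htp),
        MapsOntoOpenSubgroupOf f (D.vertGp v ⊓ augG.ker) (conjSubgroup x (D'.vertGp w) ⊓ augH'.ker)) →
      (∀ b : B, ∃ (b' : B') (x : Htp),
        MapsOntoOpenSubgroupOf f (D.brGp b ⊓ augG.ker) (conjSubgroup x (D'.brGp b') ⊓ augH'.ker)) →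
      (∀ (v₁ v₂ : V) (γ₁ γ₂ : Gtp),
        conjSubgroup γ₁ (D.vertGp v₁) ⊓ augG.ker ≠ conjSubgroup γ₂ (D.vertGp v₂) ⊓ augG.ker →
        conjSubgroup γ₁ (D.vertGp v₁) ⊓ conjSubgroup γ₂ (D.vertGp v₂) ⊓ augG.ker ≠ ⊥ →
          ∃ (w₁ w₂ : V') (x₁ x₂ : Htp),
            conjSubgroup x₁ (D'.vertGp w₁) ⊓ augH'.ker ≠ conjSubgroup x₂ (D'.vertGp w₂) ⊓ augH'.ker ∧
              (conjSubgroup γ₁ (D.vertGp v₁) ⊓ augG.ker).map f ≤ conjSubgroup x₁ (D'.vertGp w₁) ∧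
                (conjSubgroup γ₂ (D.vertGp v₂) ⊓ augG.ker).map f ≤ conjSubgroup x₂ (D'.vertGp w₂)) →
      ∃ (g : 𝔊.G ⟶ ℍ.G), ∃ h ∈ augH'.ker, ∀ x : augG.ker, f x = h * ι g x * h⁻¹)
    (hsurjG : Function.Surjective augG) (he : Continuous e) (hV : Nonempty V) :
    ∀ f : Gtp →* Htp, IsArithQuasiGeometric augG augH' f →
      (∀ K₁ H₁ : Subgroup Gtp, IsArithMaximalCompact augG K₁ → IsArithMaximalCompact augG H₁ →
        K₁ ≠ H₁ → IsArithAmple augG (K₁ ⊓ H₁) →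
          ∃ K₂ H₂ : Subgroup Htp, IsArithMaximalCompact augH' K₂ ∧ IsArithMaximalCompact augH' H₂ ∧
            K₂ ≠ H₂ ∧ K₁.map f ≤ K₂ ∧ H₁.map f ≤ H₂) →
      ∃ (φ : ArithHom 𝓥 𝔊 ℍ) (h₁ : φ.IsLocallyOpen) (h₂ : ArithHom.IsOverA 𝔊 ℍ e φ) (h : Htp),
        ∀ g, f g = h * btemp φ h₁ h₂ g * h⁻¹ :=
  Thm54iii.clause3Compat_of_geometric augG augH' btemp hIIG hIIH hRG hcommV' hadj hover ι hιG hιH hιinj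
    hιbtemp hCor39c
    (relSlim_of_commensurator_slim haugH hcommV'
      (fun w => (hRH _ (Or.inl ⟨w, 1, by ext y; simp [conjSubgroup]⟩)).1) hslim)
    hsurjG he hV

end OfSlim

end Literature.AnabelianGeometry.SemiGraphs
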